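import Summits.QuantumFields.GaugeBoot.MoveLocality
import HarnessLib

/-!
# Twistings and mergers do not lengthen loop sequences and are local (gauge-boot, ADDENDUM 30 part L)

HONEST FRAMING (cell `pub-gaugeboot`, page 1 of every file): the venture produces certified bounds
on lattice expectations at stated coupling, gauge group, dimension and torus size; NOT a mass gap,
NOT a continuum limit, NOT a string tension; NOT Yang–Mills-summit-bearing (barriers
`FixedCouplingUltralocality`, `PerturbativeInvisibility`).  Combinatorics of the loop operations of S. Chatterjee,
*Rigorous solution of strongly coupled `SO(N)` lattice gauge theory in the large `N` limit*, Comm. Math. Phys. **366** (2019)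
§2.2, as used by S. Chatterjee and J. Jafarov, *The `1/N` expansion for `SO(N)` lattice gauge theory at strong coupling*,
arXiv:1604.04777, Lemmas 4.1–4.2; nothing about four-dimensional continuum Yang–Mills or a mass gap.

## Content

For the `1/N` EXPANSION to all orders (siblings `OneOverNAPriori`, …) the twisting and merger terms of the finite-`N` master loop
equation enter the SOURCE of the linearised equations and must be controlled by a priori bounds; this needs two elementary facts:
* `len_negTwistAt_le`, `len_posTwistAt_le`, `len_posMergeAt_le`, `len_negMergeAt_le` — twistings and mergers do not increase the
  total length `|s|` (Chatterjee–Jafarov, Lemmas 4.1 and 4.2);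
* `exists_letter_of_mem_negTwistAt` … `exists_letter_of_mem_negMergeAt` — every letter of a twisting or merger result is a letter
  of `s` or the inverse of one; hence (`ball_of_letters`) any condition «the `r`-neighbourhood of the vertices lies in `Λ`»
  passes from `s` to all its twistings and mergers (`ball_negTwistAt`, `ball_posTwistAt`, `ball_posMergeAt`, `ball_negMergeAt`).

Everything is `[folklore]` given the source's definitions.
-/

noncomputable section

open Finset
open Literature.Probability.LatticeModels (Site)
open Literature.MathematicalPhysics.QuantumFieldTheory (latticeNorm)
open Literature.MathematicalPhysics.QuantumFieldTheory.Chatterjee2019LargeN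
open Literature.MathematicalPhysics.QuantumFieldTheory.Chatterjee2019LargeN.Word
  (posMergeRot negMergeRot posMerge negMerge negTwist posTwist arcBetween arcAfter gap letter length_core_le
    length_arcBetween_le length_arcAfter gap_lt gap_pos ne_of_get_eq_inv length_posMergeRot_le length_negMergeRot_le)

namespace Summit.QuantumFields.GaugeBoot

namespace StringDuality

variable {d : ℕ}

/-! ## Lengths -/

/-- `|l ∝⁻_{x,y}| ≤ |l|` for the negative twisting `[b⁻¹ c a]` of `l = a e b e c`. [cite: Chatterjee2019LargeN, §2.2 (negative twisting)] -/
theorem length_negTwist_le (l : List (DEdge d)) (x y : Fin l.length) : (negTwist l x y).length ≤ l.length := by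
  unfold Literature.MathematicalPhysics.QuantumFieldTheory.Chatterjee2019LargeN.Word.negTwist
  refine (length_core_le _).trans ?_
  rw [List.length_append, FreeGroup.invRev_length, length_arcAfter]
  have h1 := length_arcBetween_le l x y
  have h2 := gap_lt l x y
  omega

/-- `|l ∝⁺_{x,y}| ≤ |l|` for the positive twisting `[e b⁻¹ e⁻¹ c a]` of `l = a e b e⁻¹ c`. [cite: Chatterjee2019LargeN, §2.2 (positive twisting)] -/
theorem length_posTwist_le (l : List (DEdge d)) {x y : Fin l.length} (hxy : x ≠ y) : (posTwist l x y).length ≤ l.length := by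
  unfold Literature.MathematicalPhysics.QuantumFieldTheory.Chatterjee2019LargeN.Word.posTwist
  refine (length_core_le _).trans ?_
  simp only [List.cons_append, List.length_cons, List.length_append, FreeGroup.invRev_length, length_arcAfter]
  have h1 := length_arcBetween_le l x y
  have h2 := gap_lt l x y
  have h3 := gap_pos l hxy
  omega

/-- `len (l :: []) = |l|`. [folklore] -/
theorem len_singleton (w : List (DEdge d)) : LoopSeq.len [w] = w.length := by
  rw [LoopSeq.len_cons, LoopSeq.len_nil, add_zero]

/-- **Negative twistings do not lengthen**: `|s'| ≤ |s|` for `s' ∈ 𝕋⁻(s)`. [cite: Chatterjee2019LargeN, §2.2; ChatterjeeJafarov2016OneOverN, Lemma 4.1] -/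
theorem len_negTwistAt_le (s : LoopSeq d) (o : SameIdx s) : (s.negTwistAt o).len ≤ s.len := by
  have h := LoopSeq.len_replaceAt s o.1 [negTwist (s.get o.1) o.2.1.1 o.2.1.2]
  rw [len_singleton] at h
  have h2 := length_negTwist_le (s.get o.1) o.2.1.1 o.2.1.2
  unfold LoopSeq.negTwistAt
  omega

/-- **Positive twistings do not lengthen**: `|s'| ≤ |s|` for `s' ∈ 𝕋⁺(s)`. [cite: Chatterjee2019LargeN, §2.2; ChatterjeeJafarov2016OneOverN, Lemma 4.1] -/
theorem len_posTwistAt_le (s : LoopSeq d) (o : InvIdx s) : (s.posTwistAt o).len ≤ s.len := by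
  have h := LoopSeq.len_replaceAt s o.1 [posTwist (s.get o.1) o.2.1.1 o.2.1.2]
  rw [len_singleton] at h
  have h2 := length_posTwist_le (s.get o.1) (ne_of_get_eq_inv o.2.2)
  unfold LoopSeq.posTwistAt
  omega

/-- `len` of a list with one component replaced. [folklore] -/
theorem len_set : ∀ (s : LoopSeq d) (i : ℕ) (w : List (DEdge d)), i < s.length →
    LoopSeq.len (s.set i w) + (s[i]?.getD []).length = s.len + w.length
  | [], i, w, hi => by simp at hi
  | l :: s, 0, w, _ => by
      simp only [List.set_cons_zero, LoopSeq.len_cons, List.getElem?_cons_zero, Option.getD_some]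
      ring
  | l :: s, i + 1, w, hi => by
      simp only [List.set_cons_succ, LoopSeq.len_cons, List.getElem?_cons_succ]
      have := len_set s i w (by simpa using hi)
      omega

/-- `len` of a list with one component erased. [folklore] -/
theorem len_eraseIdx : ∀ (s : LoopSeq d) (j : ℕ), j < s.length →
    LoopSeq.len (s.eraseIdx j) + (s[j]?.getD []).length = s.len
  | [], j, hj => by simp at hj
  | l :: s, 0, _ => by
      simp only [List.eraseIdx_cons_zero, LoopSeq.len_cons, List.getElem?_cons_zero, Option.getD_some]
      ring
  | l :: s, j + 1, hj => by
      simp only [List.eraseIdx_cons_succ, LoopSeq.len_cons, List.getElem?_cons_succ]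
      have := len_eraseIdx s j (by simpa using hj)
      omega

/-- The common length computation of the two mergers: replacing `lᵢ` by a word of length `≤ |lᵢ| + |lⱼ|` and deleting `lⱼ`
(`i ≠ j`) does not lengthen. [cite: ChatterjeeJafarov2016OneOverN, Lemma 4.2] -/
theorem len_prune_set_eraseIdx_le (s : LoopSeq d) {i j : Fin s.length} (hij : i ≠ j) (w : List (DEdge d))
    (hw : w.length ≤ (s.get i).length + (s.get j).length) :
    (LoopSeq.prune ((s.set i w).eraseIdx j)).len ≤ s.len := by
  rw [LoopSeq.len_prune]
  have h1 := len_set s i w i.isLt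
  have hj' : (j : ℕ) < (s.set i w).length := by rw [List.length_set]; exact j.isLt
  have h2 := len_eraseIdx (s.set i w) j hj'
  have e1 : s[(i : ℕ)]?.getD [] = s.get i := by
    rw [List.getElem?_eq_getElem i.isLt, Option.getD_some, List.get_eq_getElem]
  have e2 : (s.set i w)[(j : ℕ)]?.getD [] = s.get j := by
    rw [List.getElem?_eq_getElem hj', Option.getD_some, List.get_eq_getElem]
    exact List.getElem_set_of_ne (fun h => hij (Fin.ext h)) _ hj'
  rw [e1] at h1
  rw [e2] at h2
  omega

/-- **Positive mergers do not lengthen**: `|s'| ≤ |s|` for `s' ∈ 𝕄⁺(s)`. [cite: Chatterjee2019LargeN, §2.2; ChatterjeeJafarov2016OneOverN, Lemma 4.2] -/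
theorem len_posMergeAt_le (s : LoopSeq d) (o : MergeIdx s) : (s.posMergeAt o).len ≤ s.len := by
  unfold LoopSeq.posMergeAt
  refine len_prune_set_eraseIdx_le s o.2.2.2.1 _ ?_
  unfold Literature.MathematicalPhysics.QuantumFieldTheory.Chatterjee2019LargeN.Word.posMerge
  refine (length_posMergeRot_le _ _).trans ?_
  rw [List.length_rotate, List.length_rotate]

/-- **Negative mergers do not lengthen**: `|s'| ≤ |s|` for `s' ∈ 𝕄⁻(s)`. [cite: Chatterjee2019LargeN, §2.2; ChatterjeeJafarov2016OneOverN, Lemma 4.2] -/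
theorem len_negMergeAt_le (s : LoopSeq d) (o : MergeIdx s) : (s.negMergeAt o).len ≤ s.len := by
  unfold LoopSeq.negMergeAt
  refine len_prune_set_eraseIdx_le s o.2.2.2.1 _ ?_
  unfold Literature.MathematicalPhysics.QuantumFieldTheory.Chatterjee2019LargeN.Word.negMerge
  refine (length_negMergeRot_le _ _).trans ?_
  rw [List.length_rotate, List.length_rotate]

/-! ## Letters -/

/-- The letters of the arcs `b`, `c a` of `l = a e b e' c` are letters of `l`. [cite: Chatterjee2019LargeN, §2.2 (l = aebec)] -/
theorem mem_of_mem_arcBetween {l : List (DEdge d)} {x y : Fin l.length} {a : DEdge d} (h : a ∈ arcBetween l x y) : a ∈ l :=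
  List.mem_rotate.mp (List.mem_of_mem_drop (List.mem_of_mem_take h))

/-- The letters of the arc after the second location are letters of `l`. [cite: Chatterjee2019LargeN, §2.2 (l = aebec)] -/
theorem mem_of_mem_arcAfter {l : List (DEdge d)} {x y : Fin l.length} {a : DEdge d} (h : a ∈ arcAfter l x y) : a ∈ l :=
  List.mem_rotate.mp (List.mem_of_mem_drop h)

/-- Every letter of a negative twisting `[b⁻¹ c a]` is a letter of `l` or the inverse of one. [cite: Chatterjee2019LargeN, §2.2 (negative twisting)] -/
theorem exists_letter_of_mem_negTwist {l : List (DEdge d)} {x y : Fin l.length} {a' : DEdge d} (h : a' ∈ negTwist l x y) :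
    ∃ a ∈ l, a' = a ∨ a' = DEdge.inv a := by
  unfold Literature.MathematicalPhysics.QuantumFieldTheory.Chatterjee2019LargeN.Word.negTwist at h
  have h1 := mem_of_mem_core h
  rw [List.mem_append] at h1
  rcases h1 with h1 | h1
  · obtain ⟨c, hc, rfl⟩ := exists_of_mem_invRev h1
    exact ⟨c, mem_of_mem_arcBetween hc, Or.inr rfl⟩
  · exact ⟨a', mem_of_mem_arcAfter h1, Or.inl rfl⟩

/-- Every letter of a positive twisting `[e b⁻¹ e⁻¹ c a]` is a letter of `l` or the inverse of one. [cite: Chatterjee2019LargeN, §2.2 (positive twisting)] -/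
theorem exists_letter_of_mem_posTwist {l : List (DEdge d)} {x y : Fin l.length} {a' : DEdge d} (h : a' ∈ posTwist l x y) :
    ∃ a ∈ l, a' = a ∨ a' = DEdge.inv a := by
  unfold Literature.MathematicalPhysics.QuantumFieldTheory.Chatterjee2019LargeN.Word.posTwist at h
  have h1 := mem_of_mem_core h
  simp only [List.cons_append, List.mem_cons, List.mem_append] at h1
  rcases h1 with rfl | h1 | rfl | h1
  · exact ⟨_, List.get_mem l x, Or.inl rfl⟩
  · obtain ⟨c, hc, rfl⟩ := exists_of_mem_invRev h1
    exact ⟨c, mem_of_mem_arcBetween hc, Or.inr rfl⟩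
  · exact ⟨_, List.get_mem l x, Or.inr rfl⟩
  · exact ⟨a', mem_of_mem_arcAfter h1, Or.inl rfl⟩

/-- **Negative twistings are letter-preserving**: every letter of a loop of `s' ∈ 𝕋⁻(s)` is a letter of `s` or the inverse of
one. [cite: Chatterjee2019LargeN, §2.2 (𝕋⁻(s))] -/
theorem exists_letter_of_mem_negTwistAt {s : LoopSeq d} (o : SameIdx s) {l' : List (DEdge d)} (hl' : l' ∈ s.negTwistAt o)
    {a' : DEdge d} (ha' : a' ∈ l') : ∃ l ∈ s, ∃ a ∈ l, a' = a ∨ a' = DEdge.inv a := by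
  rcases mem_or_mem_of_mem_replaceAt hl' with h | h
  · exact ⟨l', h, a', ha', Or.inl rfl⟩
  · rw [List.mem_singleton] at h
    subst h
    obtain ⟨a, ha, h⟩ := exists_letter_of_mem_negTwist ha'
    exact ⟨s.get o.1, List.get_mem s o.1, a, ha, h⟩

/-- **Positive twistings are letter-preserving.** [cite: Chatterjee2019LargeN, §2.2 (𝕋⁺(s))] -/
theorem exists_letter_of_mem_posTwistAt {s : LoopSeq d} (o : InvIdx s) {l' : List (DEdge d)} (hl' : l' ∈ s.posTwistAt o)
    {a' : DEdge d} (ha' : a' ∈ l') : ∃ l ∈ s, ∃ a ∈ l, a' = a ∨ a' = DEdge.inv a := by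
  rcases mem_or_mem_of_mem_replaceAt hl' with h | h
  · exact ⟨l', h, a', ha', Or.inl rfl⟩
  · rw [List.mem_singleton] at h
    subst h
    obtain ⟨a, ha, h⟩ := exists_letter_of_mem_posTwist ha'
    exact ⟨s.get o.1, List.get_mem s o.1, a, ha, h⟩

/-- The loops of `prune ((s.set i w).eraseIdx j)` are old loops or the inserted word. [cite: Chatterjee2019LargeN, §2.2 (mergers)] -/
theorem mem_or_eq_of_mem_prune_set_eraseIdx {s : LoopSeq d} {i j : ℕ} {w l' : List (DEdge d)}
    (h : l' ∈ LoopSeq.prune ((s.set i w).eraseIdx j)) : l' ∈ s ∨ l' = w := by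
  unfold LoopSeq.prune at h
  rw [List.mem_filter] at h
  exact List.mem_or_eq_of_mem_set (List.mem_of_mem_eraseIdx h.1)

/-- Letters of `l ⊕_{x,y} m` / `l ⊖_{x,y} m` are letters of `l`, of `m`, or inverses of letters of `m`.
[cite: Chatterjee2019LargeN, §2.2 (mergers)] -/
theorem exists_letter_of_mem_merge {l m : List (DEdge d)} {x : Fin l.length} {y : Fin m.length} {a' : DEdge d}
    (h : a' ∈ posMerge l x m y ∨ a' ∈ negMerge l x m y) :
    (∃ a ∈ l, a' = a ∨ a' = DEdge.inv a) ∨ (∃ a ∈ m, a' = a ∨ a' = DEdge.inv a) := by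
  unfold Literature.MathematicalPhysics.QuantumFieldTheory.Chatterjee2019LargeN.Word.posMerge
    Literature.MathematicalPhysics.QuantumFieldTheory.Chatterjee2019LargeN.Word.negMerge at h
  rcases mem_mergeRot h with h | h | ⟨c, hc, rfl⟩
  · exact Or.inl ⟨a', List.mem_rotate.mp h, Or.inl rfl⟩
  · exact Or.inr ⟨a', List.mem_rotate.mp h, Or.inl rfl⟩
  · exact Or.inr ⟨c, List.mem_rotate.mp hc, Or.inr rfl⟩

/-- **Positive mergers are letter-preserving**: every letter of a loop of `s' ∈ 𝕄⁺(s)` is a letter of `s` or the inverse of one.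
[cite: Chatterjee2019LargeN, §2.2 (𝕄⁺(s))] -/
theorem exists_letter_of_mem_posMergeAt {s : LoopSeq d} (o : MergeIdx s) {l' : List (DEdge d)} (hl' : l' ∈ s.posMergeAt o)
    {a' : DEdge d} (ha' : a' ∈ l') : ∃ l ∈ s, ∃ a ∈ l, a' = a ∨ a' = DEdge.inv a := by
  unfold LoopSeq.posMergeAt at hl'
  rcases mem_or_eq_of_mem_prune_set_eraseIdx hl' with h | h
  · exact ⟨l', h, a', ha', Or.inl rfl⟩
  · subst h
    rcases exists_letter_of_mem_merge (Or.inl ha') with ⟨a, ha, h⟩ | ⟨a, ha, h⟩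
    · exact ⟨_, List.get_mem s o.1, a, ha, h⟩
    · exact ⟨_, List.get_mem s o.2.1, a, ha, h⟩

/-- **Negative mergers are letter-preserving.** [cite: Chatterjee2019LargeN, §2.2 (𝕄⁻(s))] -/
theorem exists_letter_of_mem_negMergeAt {s : LoopSeq d} (o : MergeIdx s) {l' : List (DEdge d)} (hl' : l' ∈ s.negMergeAt o)
    {a' : DEdge d} (ha' : a' ∈ l') : ∃ l ∈ s, ∃ a ∈ l, a' = a ∨ a' = DEdge.inv a := by
  unfold LoopSeq.negMergeAt at hl'
  rcases mem_or_eq_of_mem_prune_set_eraseIdx hl' with h | h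
  · exact ⟨l', h, a', ha', Or.inl rfl⟩
  · subst h
    rcases exists_letter_of_mem_merge (Or.inr ha') with ⟨a, ha, h⟩ | ⟨a, ha, h⟩
    · exact ⟨_, List.get_mem s o.1, a, ha, h⟩
    · exact ⟨_, List.get_mem s o.2.1, a, ha, h⟩

/-! ## Transfer of neighbourhood conditions -/

/-- **A neighbourhood condition passes to any letter-preserving result**: if the `r`-neighbourhood of the vertices of `s` lies
in `Λ` and every letter of `s'` is a letter of `s` or the inverse of one, the `r`-neighbourhood of the vertices of `s'` lies in
`Λ`. [folklore] -/
theorem ball_of_letters {Λ : Finset (Site d)} {r : ℝ} {s s' : LoopSeq d}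
    (hs : ∀ l ∈ s, ∀ a ∈ l, ∀ v : Site d,
      latticeNorm (v - DEdge.src a) ≤ r ∨ latticeNorm (v - DEdge.tgt a) ≤ r → v ∈ Λ)
    (hsub : ∀ l' ∈ s', ∀ a' ∈ l', ∃ l ∈ s, ∃ a ∈ l, a' = a ∨ a' = DEdge.inv a) :
    ∀ l' ∈ s', ∀ a' ∈ l', ∀ v : Site d,
      latticeNorm (v - DEdge.src a') ≤ r ∨ latticeNorm (v - DEdge.tgt a') ≤ r → v ∈ Λ := by
  intro l' hl' a' ha' v hv
  obtain ⟨l, hl, a, ha, h⟩ := hsub l' hl' a' ha'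
  refine hs l hl a ha v ?_
  rcases h with rfl | rfl
  · exact hv
  · rw [DEdge.src_inv, DEdge.tgt_inv] at hv
    exact hv.symm

/-- **Neighbourhood conditions pass to all twistings and mergers** (the four families at once).
[cite: Chatterjee2019LargeN, §2.2 (𝕋^±(s), 𝕄^±(s)); ChatterjeeJafarov2016OneOverN, Lemmas 4.1–4.2 (no new edges)] -/
theorem ball_twist_merge {Λ : Finset (Site d)} {r : ℝ} {s : LoopSeq d}
    (hs : ∀ l ∈ s, ∀ a ∈ l, ∀ v : Site d,
      latticeNorm (v - DEdge.src a) ≤ r ∨ latticeNorm (v - DEdge.tgt a) ≤ r → v ∈ Λ) :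
    (∀ o : SameIdx s, ∀ l' ∈ s.negTwistAt o, ∀ a' ∈ l', ∀ v : Site d,
        latticeNorm (v - DEdge.src a') ≤ r ∨ latticeNorm (v - DEdge.tgt a') ≤ r → v ∈ Λ) ∧
      (∀ o : InvIdx s, ∀ l' ∈ s.posTwistAt o, ∀ a' ∈ l', ∀ v : Site d,
        latticeNorm (v - DEdge.src a') ≤ r ∨ latticeNorm (v - DEdge.tgt a') ≤ r → v ∈ Λ) ∧
      (∀ o : MergeIdx s, ∀ l' ∈ s.posMergeAt o, ∀ a' ∈ l', ∀ v : Site d,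
        latticeNorm (v - DEdge.src a') ≤ r ∨ latticeNorm (v - DEdge.tgt a') ≤ r → v ∈ Λ) ∧
      (∀ o : MergeIdx s, ∀ l' ∈ s.negMergeAt o, ∀ a' ∈ l', ∀ v : Site d,
        latticeNorm (v - DEdge.src a') ≤ r ∨ latticeNorm (v - DEdge.tgt a') ≤ r → v ∈ Λ) :=
  ⟨fun o => ball_of_letters hs fun _ hl' _ ha' => exists_letter_of_mem_negTwistAt o hl' ha',
    fun o => ball_of_letters hs fun _ hl' _ ha' => exists_letter_of_mem_posTwistAt o hl' ha',
    fun o => ball_of_letters hs fun _ hl' _ ha' => exists_letter_of_mem_posMergeAt o hl' ha',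
    fun o => ball_of_letters hs fun _ hl' _ ha' => exists_letter_of_mem_negMergeAt o hl' ha'⟩

end StringDuality

end Summit.QuantumFields.GaugeBoot

end
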